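/-
Copyright (c) 2026 the pub-hodgecm-mathlib formalisation cell (harness21).  Prover seat hodgecm-mathlib-LH4-p13 (g8), req620 Track A «(D-RAM) FOUR-FRAME» squad
(STAGE-1b, row (2) of the piece `f_{T₊}`, the (β₂) road; LH4-p04 (g8) 14:27:34Z ruling: (S-2) part ii «CROSS-LITERAL PLANE-SET COMPARISON on dictionary-matched Λ» → this seat;
the matching is an explicit isometry hypothesis, discharged by the (S4) owner from the order forms), 2026-09-04.
-/
import Summits.HodgeConjecture.HodgeConjecture.Theorems.F0P3cDyRamGlueLabelPlaneDominated   -- (S-2) part i (this seat): `valueSet_endoGL_sub_one_glued_eq_plane_of_line_small`; brings ★ p860233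
import Literature.NumberTheory.Automorphic.UnitaryLatticeTreeDual                         -- ★ `pairing_mulVec_left`, `pairing_mulVec_right`
import HarnessLib

/-!
# Crux `H413`, line LH4 «(D-RAM) FOUR-FRAME» — STAGE-1b, row (2), the (β₂) road, (S-2) part ii: «THE PLANE VALUE SET IS `⟨β′, (γ₂ − 1)β′⟩` AND IS TRANSPORTED BY ANY
# FORM-ISOMETRY INTERTWINING THE PLANE ELEMENTS» — so two literal models with dictionary-matched plane data have the SAME plane value set, hence (part i) the same label

Cell `hodgecm-mathlib` (D-0151), FLOOR 0, crux item H413 = `stmt-HodgeConjecture-24833`, route of record `HCCMUnconditional`; squad F0∕P3c∕LH4; lane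
`--supports stmt-HodgeConjecture-24833 --as helper` (count-neutral; pays NO tier-0 row).  THEOREMS ONLY (no `def`, no instance, no notation, no `sorry`, default heartbeats).
DATUM-FREE plane algebra in ★ p860233's letters.
* §1 `planeTerm_eq_pairing_sub_one` — the plane term of ★ p860233 SIMPLIFIES: `⟨v, (γ₂ − u₀₀·1)v⟩ + (u₀₀ − 1)⟨v, v⟩ = ⟨v, (γ₂ − 1)v⟩` (the unit `u₀₀` drops out of the plane part).
* §2 `pairing_sub_one_eq_of_isometry` — for `ψ` with `⟨ψx, ψy⟩_{H₂′} = ⟨x, y⟩_{H₂}` and `ψγ₂ = γ₂′ψ`: `⟨ψv, (γ₂′ − 1)ψv⟩_{H₂′} = ⟨v, (γ₂ − 1)v⟩_{H₂}`.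
* §3 HEAD `planeValueSet_eq_of_isometry` — the two thickened plane value sets of ★ p860233 (in its exact RHS letters, units `u`, `u′` arbitrary) over `(B₂, w₀)` and the matched
  `(B₂′, ψw₀)` (`B₂′ = ψ(B₂)` as a membership hypothesis) COINCIDE; with part i: `valueSet_glued_eq_of_isometry_of_line_small` — two plane-dominated glued vertices in the two
  literal models `block(H₂, h)`, `block(H₂′, h′)` over matched plane data have the same value set of `Γ − 1`, `Γ′ − 1` (any glue scalars).
HONEST LABEL.  Count-neutral lattice algebra; nothing printed is asserted; no census law is stated; (β₂) stays a HYPOTHESIS; `HC_CM` is proved only modulo the 7 printed citations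
(2 remaining named inputs: hLiu418 = `stmt-HodgeConjecture-24832`, h413 = `stmt-HodgeConjecture-24833`) until rung 0 closes.
## References
* [Jacobowitz1962] R. Jacobowitz, *Hermitian forms over local fields*, Amer. J. Math. 84 (1962): §4 (change of basis for hermitian pairings; gluing).
* [Rogawski1990] J. D. Rogawski, *Automorphic Representations of Unitary Groups in Three Variables*, Ann. of Math. Stud. 123 (1990): §4.9 Prop. 4.9.1 (b) p. 55.
* [Kottwitz1986BaseChangeUnits] R. E. Kottwitz, *Base change for unit elements of Hecke algebras*, Compositio Math. 60 (1986): §1 pp. 240–241.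
-/

set_option autoImplicit false

noncomputable section
namespace Summit.HodgeConjecture.HodgeConjecture.Cruxes.H413.F0P3cDyRamGluePlaneSetTransport

open scoped Valued WithZero Matrix MatrixGroups
open Literature.NumberTheory.Automorphic Literature.NumberTheory.Automorphic.HermitianLattice Literature.NumberTheory.Automorphic.UnitaryLatticeTree
open Literature.NumberTheory.Rogawski1990
open Summit.HodgeConjecture.HodgeConjecture.Cruxes.H413.F0P3cDyRamBlockGlueValueSet
open Summit.HodgeConjecture.HodgeConjecture.Cruxes.H413.F0P3cDyRamGlueLabelPlaneDominated

variable {K : Type*} [Field K] [Valued K ℤᵐ⁰]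

/-! ## §1 The plane term is `⟨v, (γ₂ − 1)v⟩` -/

omit [Valued K ℤᵐ⁰] in
/-- **THE PLANE TERM SIMPLIFIES**: `⟨v, (γ₂ − u₀₀·1)v⟩_{H₂} + (u₀₀ − 1)·⟨v, v⟩_{H₂} = ⟨v, (γ₂ − 1)v⟩_{H₂}` (the pairing is linear in its second argument). [cite: Jacobowitz1962, §4] -/
theorem planeTerm_eq_pairing_sub_one (σ : K →+* K) (H₂ γ₂ : Matrix (Fin 2) (Fin 2) K) (u₀₀ : K) (v : Fin 2 → K) :
    pairing σ H₂ v ((γ₂ - u₀₀ • (1 : Matrix (Fin 2) (Fin 2) K)) *ᵥ v) + (u₀₀ - 1) * pairing σ H₂ v v = pairing σ H₂ v ((γ₂ - 1) *ᵥ v) := by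
  have e1 : (γ₂ - u₀₀ • (1 : Matrix (Fin 2) (Fin 2) K)) *ᵥ v = (γ₂ - 1) *ᵥ v - (u₀₀ - 1) • v := by
    rw [Matrix.sub_mulVec, Matrix.sub_mulVec, Matrix.smul_mulVec, Matrix.one_mulVec, sub_smul, one_smul]; abel
  rw [e1, map_sub, map_smul, smul_eq_mul]; ring

/-! ## §2 Transport of `⟨v, (γ − 1)v⟩` under a form-isometry intertwining the plane elements -/

omit [Valued K ℤᵐ⁰] in
/-- **TRANSPORT**: if `⟨ψx, ψy⟩_{H₂′} = ⟨x, y⟩_{H₂}` for all `x, y` and `ψγ₂ = γ₂′ψ`, then `⟨ψv, (γ₂′ − 1)(ψv)⟩_{H₂′} = ⟨v, (γ₂ − 1)v⟩_{H₂}`. [cite: Jacobowitz1962, §4] -/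
theorem pairing_sub_one_eq_of_isometry (σ : K →+* K) (H₂ H₂' γ₂ γ₂' ψ : Matrix (Fin 2) (Fin 2) K)
    (hψ : ∀ x y : Fin 2 → K, pairing σ H₂' (ψ *ᵥ x) (ψ *ᵥ y) = pairing σ H₂ x y) (hγ : ψ * γ₂ = γ₂' * ψ) (v : Fin 2 → K) :
    pairing σ H₂' (ψ *ᵥ v) ((γ₂' - 1) *ᵥ (ψ *ᵥ v)) = pairing σ H₂ v ((γ₂ - 1) *ᵥ v) := by
  have e : (γ₂' - 1) *ᵥ (ψ *ᵥ v) = ψ *ᵥ ((γ₂ - 1) *ᵥ v) := by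
    rw [Matrix.mulVec_mulVec, Matrix.mulVec_mulVec, sub_mul, mul_sub, one_mul, mul_one, hγ]
  rw [e, hψ]

/-! ## §3 HEAD — the two plane value sets coincide; with part i, so do the two glued value sets -/

/-- **THE PLANE VALUE SETS OF TWO MATCHED MODELS COINCIDE.**  `ψ` a form-isometry `(H₂) → (H₂′)` with `ψγ₂ = γ₂′ψ`; plane data `(B₂, w₀)` and `(B₂′, ψw₀)` with `B₂′ = ψ(B₂)`
(membership hypothesis).  Then ★ p860233's thickened plane sets (its RHS letters with the line term removed; the units `u, u′` arbitrary — they drop out by §1) are EQUAL.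
[cite: Jacobowitz1962, §4] [cite: Rogawski1990, §4.9 Prop. 4.9.1 (b) p. 55] -/
theorem planeValueSet_eq_of_isometry (σ : K →+* K) (ϖ : K) (m : ℕ) (H₂ H₂' : Matrix (Fin 2) (Fin 2) K) (γ₂ γ₂' : GL (Fin 2) K) (ψ : Matrix (Fin 2) (Fin 2) K)
    (hψ : ∀ x y : Fin 2 → K, pairing σ H₂' (ψ *ᵥ x) (ψ *ᵥ y) = pairing σ H₂ x y)
    (hγ : ψ * (γ₂ : Matrix (Fin 2) (Fin 2) K) = (γ₂' : Matrix (Fin 2) (Fin 2) K) * ψ)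
    {B₂ B₂' : Submodule 𝒪[K] (Fin 2 → K)} (hB : ∀ β' : Fin 2 → K, β' ∈ B₂' ↔ ∃ β ∈ B₂, β' = ψ *ᵥ β) (w₀ : Fin 2 → K) (u₀₀ u₀₀' : K) :
    {z : K | ∃ β ∈ B₂, ∃ a : K, Valued.v a ≤ 1 ∧
        Valued.v ((ϖ ^ m)⁻¹ * (z - (pairing σ H₂ (β + a • w₀) ((((γ₂ : Matrix (Fin 2) (Fin 2) K) - u₀₀ • (1 : Matrix (Fin 2) (Fin 2) K))) *ᵥ (β + a • w₀)) +
          (u₀₀ - 1) * pairing σ H₂ (β + a • w₀) (β + a • w₀)))) ≤ 1} =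
      {z : K | ∃ β' ∈ B₂', ∃ a : K, Valued.v a ≤ 1 ∧
        Valued.v ((ϖ ^ m)⁻¹ * (z - (pairing σ H₂' (β' + a • (ψ *ᵥ w₀)) ((((γ₂' : Matrix (Fin 2) (Fin 2) K) - u₀₀' • (1 : Matrix (Fin 2) (Fin 2) K))) *ᵥ (β' + a • (ψ *ᵥ w₀))) +
          (u₀₀' - 1) * pairing σ H₂' (β' + a • (ψ *ᵥ w₀)) (β' + a • (ψ *ᵥ w₀))))) ≤ 1} := by
  ext z
  simp only [Set.mem_setOf_eq, planeTerm_eq_pairing_sub_one]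
  constructor
  · rintro ⟨β, hβ, a, ha, hz⟩
    refine ⟨ψ *ᵥ β, (hB _).2 ⟨β, hβ, rfl⟩, a, ha, ?_⟩
    rw [show ψ *ᵥ β + a • (ψ *ᵥ w₀) = ψ *ᵥ (β + a • w₀) by rw [Matrix.mulVec_add, Matrix.mulVec_smul],
      pairing_sub_one_eq_of_isometry σ H₂ H₂' γ₂ γ₂' ψ hψ hγ]
    exact hz
  · rintro ⟨β', hβ', a, ha, hz⟩
    obtain ⟨β, hβ, rfl⟩ := (hB β').1 hβ'
    refine ⟨β, hβ, a, ha, ?_⟩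
    rw [show ψ *ᵥ β + a • (ψ *ᵥ w₀) = ψ *ᵥ (β + a • w₀) by rw [Matrix.mulVec_add, Matrix.mulVec_smul],
      pairing_sub_one_eq_of_isometry σ H₂ H₂' γ₂ γ₂' ψ hψ hγ] at hz
    exact hz

/-- **(S-2) ON PLANE-DOMINATED MATCHED CELLS THE TWO LITERALS' GLUED VALUE SETS COINCIDE.**  Two glued vertices `M` (form `block(H₂, h)`, element `ι(γ₂, u)`, plane data `(B₂, w₀, b)`,
glue `x₀`) and `M′` (form `block(H₂′, h′)`, element `ι(γ₂′, u′)`, plane data `(ψB₂, ψw₀, b)`, glue `x₀′`) with `ψ` a form-isometry intertwining `γ₂, γ₂′`, BOTH plane-dominated at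
level `m` (line terms `ϖ^m`-small): their `ϖ^m`-thickened value sets of `Γ − 1`, `Γ′ − 1` are EQUAL — whatever the glue scalars and the units `u, u′` (part i twice + §3).
[cite: Jacobowitz1962, §4] [cite: Rogawski1990, §4.9 Prop. 4.9.1 (b) p. 55] [cite: Kottwitz1986BaseChangeUnits, §1 pp. 240–241] -/
theorem valueSet_glued_eq_of_isometry_of_line_small (σ : K →+* K) (hvσ : ∀ x, Valued.v (σ x) = Valued.v x) {ϖ : K} (hϖ : Valued.v ϖ = WithZero.exp (-1 : ℤ))
    (H₂ H₂' : Matrix (Fin 2) (Fin 2) K) (h h' : K) (γ₂ γ₂' : GL (Fin 2) K) (u u' : GL (Fin 1) K) (ψ : Matrix (Fin 2) (Fin 2) K)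
    (hψ : ∀ x y : Fin 2 → K, pairing σ H₂' (ψ *ᵥ x) (ψ *ᵥ y) = pairing σ H₂ x y)
    (hγ : ψ * (γ₂ : Matrix (Fin 2) (Fin 2) K) = (γ₂' : Matrix (Fin 2) (Fin 2) K) * ψ)
    {M M' : Submodule 𝒪[K] (Fin 3 → K)} {b : ℕ} (hpr : ∀ x ∈ M, Valued.v (x 1) * Valued.v ϖ ^ b ≤ 1) (hpr' : ∀ x ∈ M', Valued.v (x 1) * Valued.v ϖ ^ b ≤ 1)
    {B₂ B₂' : Submodule 𝒪[K] (Fin 2 → K)} (hBB : ∀ β' : Fin 2 → K, β' ∈ B₂' ↔ ∃ β ∈ B₂, β' = ψ *ᵥ β) {w₀ : Fin 2 → K} {x₀ x₀' : Fin 3 → K}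
    (hB : B₂.map ((Matrix.toLin' (!![1, 0; 0, 0; 0, 1] : Matrix (Fin 3) (Fin 2) K)).restrictScalars 𝒪[K]) =
      M ⊓ LinearMap.ker ((LinearMap.proj (1 : Fin 3) : (Fin 3 → K) →ₗ[K] K).restrictScalars 𝒪[K]))
    (hB' : B₂'.map ((Matrix.toLin' (!![1, 0; 0, 0; 0, 1] : Matrix (Fin 3) (Fin 2) K)).restrictScalars 𝒪[K]) =
      M' ⊓ LinearMap.ker ((LinearMap.proj (1 : Fin 3) : (Fin 3 → K) →ₗ[K] K).restrictScalars 𝒪[K]))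
    (hx₀ : x₀ ∈ M) (hx₀' : x₀' ∈ M') (hx₀1 : Valued.v (x₀ 1) * Valued.v ϖ ^ b = 1) (hx₀'1 : Valued.v (x₀' 1) * Valued.v ϖ ^ b = 1)
    (hprx : x₀ - Pi.single 1 (x₀ 1) = ![w₀ 0, 0, w₀ 1]) (hprx' : x₀' - Pi.single 1 (x₀' 1) = ![(ψ *ᵥ w₀) 0, 0, (ψ *ᵥ w₀) 1]) (m : ℕ)
    (hline : Valued.v ((ϖ ^ m)⁻¹ * (((u : Matrix (Fin 1) (Fin 1) K) 0 0 - 1) * (σ (x₀ 1) * h * x₀ 1))) ≤ 1)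
    (hline' : Valued.v ((ϖ ^ m)⁻¹ * (((u' : Matrix (Fin 1) (Fin 1) K) 0 0 - 1) * (σ (x₀' 1) * h' * x₀' 1))) ≤ 1) :
    {z : K | ∃ y ∈ M, Valued.v ((ϖ ^ m)⁻¹ * (z - pairing σ (!![H₂ 0 0, 0, H₂ 0 1; 0, h, 0; H₂ 1 0, 0, H₂ 1 1] : Matrix (Fin 3) (Fin 3) K) y ((((endoGL (γ₂, u) : GL (Fin 3) K) : Matrix (Fin 3) (Fin 3) K) - 1) *ᵥ y))) ≤ 1} =
      {z : K | ∃ y ∈ M', Valued.v ((ϖ ^ m)⁻¹ * (z - pairing σ (!![H₂' 0 0, 0, H₂' 0 1; 0, h', 0; H₂' 1 0, 0, H₂' 1 1] : Matrix (Fin 3) (Fin 3) K) y ((((endoGL (γ₂', u') : GL (Fin 3) K) : Matrix (Fin 3) (Fin 3) K) - 1) *ᵥ y))) ≤ 1} := by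
  rw [valueSet_endoGL_sub_one_glued_eq_plane_of_line_small σ hvσ hϖ H₂ h hpr hB hx₀ hx₀1 hprx γ₂ u m hline,
    valueSet_endoGL_sub_one_glued_eq_plane_of_line_small σ hvσ hϖ H₂' h' hpr' hB' hx₀' hx₀'1 hprx' γ₂' u' m hline']
  exact planeValueSet_eq_of_isometry σ ϖ m H₂ H₂' γ₂ γ₂' ψ hψ hγ hBB w₀ _ _

end Summit.HodgeConjecture.HodgeConjecture.Cruxes.H413.F0P3cDyRamGluePlaneSetTransport

end
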